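import Summits.BirchSwinnertonDyer.BirchSwinnertonDyer.Theses.PrintX10b
import Summits.BirchSwinnertonDyer.Rank1Residual.X10.GreenbergMuBridgeSmallImage
import Literature.NumberTheory.EllipticCurves.SkinnerUrban2014.PAdicUnitPeriodRatioProofs
import Literature.NumberTheory.EllipticCurves.Greenberg1999.RankZeroEulerCharacteristicOddPrimeProofs
import Literature.NumberTheory.EllipticCurves.PadicSigmaThreeExistence
import HarnessLib

/-!
# Route PrintX10b — the GREENBERG ROAD in the route's currency: the leaf `X10.BSDpOnClassX10b` (and the
# corner `WAllCornerX10b`) from the class-restricted ALGEBRAIC `μ = 0` at `3` + `SchneiderX10bRankOne`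
# + print, with NO Kato fine-quotient package (aside 19843 / conjunct `hfine` NOT used)

Cell `bsd-print-x9` (D-0131 (2) PRINT tier, leaves ClassX9 + ClassX10b), seat `bsd-print-x9-p1` (prover p1,
strategy «BCS under irreducibility by name ⇒ BSD_p r ≤ 1; discharge per class»), gen 2. Support file of
the Assembly item stmt-BirchSwinnertonDyer-20685 (an ALTERNATIVE decomposition, banked; the route's own
assembly `AnalyticMuZeroX10b → SchneiderX10bRankOne → PrintFactsX10b → leaf` is
`printX10b_assembly_proof`, Theorems/PrintX10bAssembly).

HONEST FRAMING. BSD is not proved; no class is closed; nothing is booked. Route PrintX10b (rev 0) reaches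
the leaf through Kato's fine-quotient zeta package at `3` (`PrintFactsX10b` conjunct 7 =
`Kato2004.exists_divisibilityInputs_fineQuotient_zeta`, aside 19843, registry flag E114 — LITERAL currency)
and the ANALYTIC crux `AnalyticMuZeroX10b` (20682). This file records the second road, landed today in
`Rank1Residual/X10/GreenbergMuBridge{,Data,SmallImage}.lean` (p540919, p545070, p546133), read on the
route's declarations:

  (μ3) ∧ `SchneiderX10bRankOne` ∧ twelve named facts ⟹ `X10.BSDpOnClassX10b` ⟹ `WAllCornerX10b`,

where (μ3) = «for every globally minimal `V/ℚ` good ordinary at `3` with `E[3]` irreducible and `ρ̄_{V,3}`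
NOT surjective, every cyclotomic datum `(κ, γ)` and every `Λ`-torsion dual Selmer datum `D` of `V` over
`ℚ_∞`, `μ(D) = 0`» (Greenberg's Conj. 1.11 on the twist-closed envelope of X10b, ALGEBRAIC side; spelled
inline), and the twelve facts are the six F1-free conjuncts of `PrintFactsX10b` (Yan–Zhu Thm 4.9 `hYZ`,
Mazur 1978 odd Manin constant `hM`, Schneider 1985 `hS`, Perrin-Riou `hPR`, modularity `hmodP`, GZK `hGZK`)
plus six more PUBLISHED inputs (Yan–Zhu Thm 4.2 (1) `h42`, Lemma 5.3 `h53`, Prop 3.7 `h37`; modularity as a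
newform `hmod`; Matar–Nekovář Prop 5.26 (2) `h526`, (3) `h526c`). The odd-prime binders Mazur–Tate σ and
Greenberg Thm 4.1 are DISCHARGED in the tree (`mazur_tate_sigma_exists_odd_holds`,
`greenberg_charValue_rankZero_of_Schneider1985_odd`), the period unit at `3` comes from `hM`
(`SkinnerUrban2014.realPeriodRat_eq_unit_mul_plusPeriod_three_of_mazur`).

WHAT THIS GIVES THE PLANNER (numbers): a rev-1 option for PrintX10b with cruxes {(μ3), SchneiderX10bRankOne}
and 12 PUB asides, 0 construction-fact (F1) asides; flags riding: `YZ26@3-BF-ERL-Ohta` (on `hYZ`, `h42`) —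
versus rev 0's {AnalyticMuZeroX10b, SchneiderX10bRankOne} + 7 asides incl. F1 (E114). Both μ-cruxes are
Greenberg's Conjecture 1.11 at `3` on the class (analytic vs algebraic side); (μ3) ⟹ `AnalyticMuZeroX10b`
modulo the same print (`printX10b_analyticMuZeroX10b_of_muZeroSmallImageThree` below). beyond-print
theorem: no.

References: [GreenbergLNM1716] §1 Conj. 1.11, Thm. 4.1; [YanZhu2024MainConjNonCM] Thm. 4.2 (1), Thm. 4.9
(v2) = Thm. 5.2 (v4) and its proof, Lemma 5.3, Prop. 3.7; [MatarNekovar2019] Prop. 5.26 (2), (3);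
[Mazur1978] Cor. 4.1; [Schneider1985]; [PerrinRiou1987] §1.4; [MazurSteinTate2006] Thm. 1.3; [Miller2011LMS]
Def. 1.1.
-/

set_option autoImplicit false

noncomputable section

open scoped Classical

open WeierstrassCurve Literature.NumberTheory.GaloisRepresentations
open Literature.NumberTheory.EllipticCurves Literature.NumberTheory.EllipticCurves.ModularForms
  Literature.NumberTheory.EllipticCurves.Rank1Residual
open Literature.NumberTheory.EllipticCurves.YanZhu2026
open Summit.BirchSwinnertonDyer.BirchSwinnertonDyer.Theses

namespace Summit.BirchSwinnertonDyer.Rank1Residual.X10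

/-- **Crux 20682 (`AnalyticMuZeroX10b`) from the ALGEBRAIC class-restricted `μ = 0` (μ3), modulo print.**
(μ3) + Yan–Zhu Thm 4.2 (1) / Thm 4.9 / Lemma 5.3 / Prop 3.7 + modularity (`hmod`, `hmodP`) + Mazur's odd
Manin constant (`hM`, giving the period unit at `3`) + Matar–Nekovář 5.26 (2)(3) ⟹ the route's crux
`Theses.PrintX10b.AnalyticMuZeroX10b` (= `X10.AnalyticMuZeroOnClassX10b`): the analytic and algebraic
`μ`-cruxes at `3` on X10b are one statement modulo print, in this direction. CONDITIONAL on (μ3); nothing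
booked. [cite: GreenbergLNM1716, §1 Conj. 1.11] [cite: YanZhu2024MainConjNonCM, Thm. 4.9 (v2) = Thm. 5.2 (v4)]
[cite: Mazur1978, Cor. 4.1] -/
theorem printX10b_analyticMuZeroX10b_of_muZeroSmallImageThree
    (hμ3 : ∀ (V : WeierstrassCurve ℚ) [V.IsElliptic] [V.IsGloballyMinimal],
      V.HasGoodReductionAtPrime 3 → ¬ ((3 : ℕ) : ℤ) ∣ V.frobeniusTrace 3 →
      V.HasIrreducibleModPGaloisRep 3 → ¬ V.HasSurjectiveModNGaloisRep 3 →
      ∀ (κ : ZpExtension ℚ 3) (γ : Field.absoluteGaloisGroup ℚ),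
        κ.IsCyclotomic → κ.IsTopGenerator γ → IsCyclotomicVariable 3 γ →
        ∀ D : V.SelmerDualData κ γ, D.IsTorsion → D.mu = 0)
    (h42 : thm42_XOrd₂_isTorsion_charIdeal_le_perrinRiou)
    (hYZ : thm49_charIdeal_eq_padicLFunction)
    (h53 : lemma53_charIdeal_mul_charIdeal_le_toPlus_charIdeal)
    (h37 : prop37_cycRestrict_perrinRiou_eq_padicLFunction_mul)
    (hmod : exists_isNewformOf) (hmodP : nonempty_modularParametrizationData)
    (hM : mazur_not_dvd_maninConstant_of_odd)
    (h526 : MatarNekovar2019.prop526_hasIrreducibleModPGaloisRep_baseChange)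
    (h526c : MatarNekovar2019.prop526_three_of_irreducible_of_not_isAbsolutelyIrreducible) :
    PrintX10b.AnalyticMuZeroX10b :=
  analyticMuZeroOnClassX10b_of_muZeroSmallImageThree hμ3 h42 hYZ h53 h37 hmod hmodP
    (SkinnerUrban2014.realPeriodRat_eq_unit_mul_plusPeriod_three_of_mazur hM) h526 h526c

/-- **The leaf `X10.BSDpOnClassX10b` on the GREENBERG ROAD, in the route's currency.** Hypotheses: (μ3)
(inline), the route's crux `SchneiderX10bRankOne` (20683), the six F1-FREE conjuncts of `PrintFactsX10b`
(`hYZ`, `hM`, `hS`, `hPR`, `hmodP`, `hGZK` — asides 20686, 19383, 19470, 19471, 19266, 19921) and six more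
PUBLISHED facts (`h42`, `h53`, `h37`, `hmod`, `h526`, `h526c`). NOT used: Kato's fine-quotient package
(aside 19843) and the analytic crux 20682. Proof: `bsdpOnClassX10b_of_muZeroSmallImageThree` with Mazur–Tate
σ and Greenberg Thm 4.1 discharged by the tree (`mazur_tate_sigma_exists_odd_holds`,
`greenberg_charValue_rankZero_of_Schneider1985_odd`) and the period unit at `3` from `hM`. CONDITIONAL on
(μ3) and C3; flag `YZ26@3-BF-ERL-Ohta` rides on `hYZ`/`h42`; nothing booked; beyond-print theorem: no.
[cite: GreenbergLNM1716, §1 Conj. 1.11 and Thm. 4.1 (p. 102)] [cite: Miller2011LMS, §1 and Def. 1.1]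
[cite: YanZhu2024MainConjNonCM, Thm. 4.9 (v2) = Thm. 5.2 (v4) and its proof] [cite: Mazur1978, Cor. 4.1]
[cite: MatarNekovar2019, Prop. 5.26 (2), (3)] -/
theorem printX10b_bsdpOnClassX10b_of_muZeroSmallImageThree
    (hμ3 : ∀ (V : WeierstrassCurve ℚ) [V.IsElliptic] [V.IsGloballyMinimal],
      V.HasGoodReductionAtPrime 3 → ¬ ((3 : ℕ) : ℤ) ∣ V.frobeniusTrace 3 →
      V.HasIrreducibleModPGaloisRep 3 → ¬ V.HasSurjectiveModNGaloisRep 3 →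
      ∀ (κ : ZpExtension ℚ 3) (γ : Field.absoluteGaloisGroup ℚ),
        κ.IsCyclotomic → κ.IsTopGenerator γ → IsCyclotomicVariable 3 γ →
        ∀ D : V.SelmerDualData κ γ, D.IsTorsion → D.mu = 0)
    (hC3 : PrintX10b.SchneiderX10bRankOne)
    (hYZ : thm49_charIdeal_eq_padicLFunction) (hM : mazur_not_dvd_maninConstant_of_odd)
    (hS : Schneider1985_order_charGenerator_odd) (hPR : perrinRiou_rankOne_leadingTerms_odd)
    (hmodP : nonempty_modularParametrizationData) (hGZK : rank_eq_analyticRank_of_analyticRank_le_one)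
    (h42 : thm42_XOrd₂_isTorsion_charIdeal_le_perrinRiou)
    (h53 : lemma53_charIdeal_mul_charIdeal_le_toPlus_charIdeal)
    (h37 : prop37_cycRestrict_perrinRiou_eq_padicLFunction_mul)
    (hmod : exists_isNewformOf)
    (h526 : MatarNekovar2019.prop526_hasIrreducibleModPGaloisRep_baseChange)
    (h526c : MatarNekovar2019.prop526_three_of_irreducible_of_not_isAbsolutelyIrreducible) :
    BSDpOnClassX10b :=
  bsdpOnClassX10b_of_muZeroSmallImageThree hμ3 h42 hYZ h53 h37 hmod hmodP
    (SkinnerUrban2014.realPeriodRat_eq_unit_mul_plusPeriod_three_of_mazur hM) h526 h526c hS hPR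
    mazur_tate_sigma_exists_odd_holds
    (greenberg_charValue_rankZero_of_Schneider1985_odd hS mazur_tate_sigma_exists_odd_holds) hGZK hC3

/-- **The same road from Greenberg's Conjecture 1.11 (irreducible form, the typed leaf
`Rank1Residual.GreenbergMuConjectureIrreducible`)** in place of (μ3) — its special case `p = 3`
(`muZeroSmallImageThree_of_greenbergMuConjectureIrreducible`). CONDITIONAL; nothing booked.
[cite: GreenbergLNM1716, §1 Conj. 1.11 and Thm. 4.1 (p. 102)] [cite: Miller2011LMS, §1 and Def. 1.1] -/
theorem printX10b_bsdpOnClassX10b_of_greenbergMuConjectureIrreducible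
    (hGrμ : Summit.BirchSwinnertonDyer.Rank1Residual.GreenbergMuConjectureIrreducible)
    (hC3 : PrintX10b.SchneiderX10bRankOne)
    (hYZ : thm49_charIdeal_eq_padicLFunction) (hM : mazur_not_dvd_maninConstant_of_odd)
    (hS : Schneider1985_order_charGenerator_odd) (hPR : perrinRiou_rankOne_leadingTerms_odd)
    (hmodP : nonempty_modularParametrizationData) (hGZK : rank_eq_analyticRank_of_analyticRank_le_one)
    (h42 : thm42_XOrd₂_isTorsion_charIdeal_le_perrinRiou)
    (h53 : lemma53_charIdeal_mul_charIdeal_le_toPlus_charIdeal)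
    (h37 : prop37_cycRestrict_perrinRiou_eq_padicLFunction_mul)
    (hmod : exists_isNewformOf)
    (h526 : MatarNekovar2019.prop526_hasIrreducibleModPGaloisRep_baseChange)
    (h526c : MatarNekovar2019.prop526_three_of_irreducible_of_not_isAbsolutelyIrreducible) :
    BSDpOnClassX10b :=
  printX10b_bsdpOnClassX10b_of_muZeroSmallImageThree
    (muZeroSmallImageThree_of_greenbergMuConjectureIrreducible hGrμ) hC3 hYZ hM hS hPR hmodP hGZK h42 h53
    h37 hmod h526 h526c

/-- **The route's `closes`-target `WAllCornerX10b` on the Greenberg road**: the leaf implies the W-ALL/10b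
corner (`WAll.wallCornerX10b_of_bsdpOnClassX10b`, as in the route's deciding theorem). CONDITIONAL on (μ3)
and C3; nothing booked. [cite: GreenbergLNM1716, §1 Conj. 1.11] [cite: Miller2011LMS, §1 and Def. 1.1] -/
theorem printX10b_wallCornerX10b_of_muZeroSmallImageThree
    (hμ3 : ∀ (V : WeierstrassCurve ℚ) [V.IsElliptic] [V.IsGloballyMinimal],
      V.HasGoodReductionAtPrime 3 → ¬ ((3 : ℕ) : ℤ) ∣ V.frobeniusTrace 3 →
      V.HasIrreducibleModPGaloisRep 3 → ¬ V.HasSurjectiveModNGaloisRep 3 →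
      ∀ (κ : ZpExtension ℚ 3) (γ : Field.absoluteGaloisGroup ℚ),
        κ.IsCyclotomic → κ.IsTopGenerator γ → IsCyclotomicVariable 3 γ →
        ∀ D : V.SelmerDualData κ γ, D.IsTorsion → D.mu = 0)
    (hC3 : PrintX10b.SchneiderX10bRankOne)
    (hYZ : thm49_charIdeal_eq_padicLFunction) (hM : mazur_not_dvd_maninConstant_of_odd)
    (hS : Schneider1985_order_charGenerator_odd) (hPR : perrinRiou_rankOne_leadingTerms_odd)
    (hmodP : nonempty_modularParametrizationData) (hGZK : rank_eq_analyticRank_of_analyticRank_le_one)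
    (h42 : thm42_XOrd₂_isTorsion_charIdeal_le_perrinRiou)
    (h53 : lemma53_charIdeal_mul_charIdeal_le_toPlus_charIdeal)
    (h37 : prop37_cycRestrict_perrinRiou_eq_padicLFunction_mul)
    (hmod : exists_isNewformOf)
    (h526 : MatarNekovar2019.prop526_hasIrreducibleModPGaloisRep_baseChange)
    (h526c : MatarNekovar2019.prop526_three_of_irreducible_of_not_isAbsolutelyIrreducible) :
    Summit.BirchSwinnertonDyer.WAllCornerX10b :=
  Summit.BirchSwinnertonDyer.Rank1Residual.WAll.wallCornerX10b_of_bsdpOnClassX10b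
    (printX10b_bsdpOnClassX10b_of_muZeroSmallImageThree hμ3 hC3 hYZ hM hS hPR hmodP hGZK h42 h53 h37
      hmod h526 h526c)

end Summit.BirchSwinnertonDyer.Rank1Residual.X10

end
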